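import Literature.Analysis.SegalBargmann.HermiteParsevalFamily
import HarnessLib

/-!
# Calculus of finite Hermite sums: supports, Parseval, and the `L²` size of `Z_j`, `Z_j^*` (Folland 1989, §1.7)

Topic `Analysis/SegalBargmann`; namespace `Literature.Analysis.SegalBargmann`.  Continuation of
`Literature.Analysis.SegalBargmann.HermiteParsevalFamily`.  A Schwartz function `F` on `ℝ^σ` is a FINITE HERMITE SUM
supported on a finite set `S` of multi-indices, `IsHermiteSum S F`, when `F = Σ_{β∈S} c_β(F) h_β` with its own Hermite
coefficients `c_β(F) = hermiteCoeff β F`.  This file is the bookkeeping of that notion: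

* §1 closure under sums and scalars, monotonicity in `S`, vanishing of the coefficients off `S`, and PARSEVAL
  `∫ ‖F‖² = Σ_{β∈S} ‖c_β(F)‖²` (`IsHermiteSum.integral_norm_sq`);
* §2 the ladder operators on Hermite sums (Folland (1.82)): `Z_j^* F`, `Z_j F` are Hermite sums supported on the shifted
  sets `S + 1_j`, `S − 1_j`, with the EXACT Parseval values `∫ ‖Z_j^* F‖² = Σ_β ‖c_β‖² (β_j+1)/π`,
  `∫ ‖Z_j F‖² = Σ_β ‖c_β‖² β_j/π`, hence `≤ (d+1)/π · ∫‖F‖²`, resp. `≤ d/π · ∫‖F‖²`, when `β_j ≤ d` on `S`;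
* §3 the elementary `L²` inequalities `∫‖u ± v‖² ≤ 2∫‖u‖² + 2∫‖v‖²`, `∫‖a u‖² = ‖a‖² ∫‖u‖²` for Schwartz functions
  (used in the sequel `HermiteSumOperators` for `x_j = ½(Z_j + Z_j^*)` and `D_j = (i/2)(Z_j^* − Z_j)`).

These are the WEIGHTED-`L²` GROWTH ESTIMATES for Hermite expansions in operator form (each ladder operator costs a
factor `√((d+1)/π)` in `L²` and one degree), the input of the polynomial sup-norm and Schwartz-seminorm bounds for the
Hermite functions (the hard half of the `N`-representation theorem for `𝒮(ℝⁿ)`).  Everything is proved from Mathlib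
and the imported tree files; no cited fact is used as a hypothesis.

## References

* G. B. Folland, *Harmonic Analysis in Phase Space*, Annals of Mathematics Studies 122, Princeton UP (1989), §1.7,
  (1.82) and (vii).  [cite: Folland1989, §1.7]
* M. Reed, B. Simon, *Methods of Modern Mathematical Physics I*, Appendix to §V.3 (the `N`-representation of `𝒮`).

## Provenance

Written for the tree under the LEAN-IN-TREE rule (2026-08-18) by the pub-hodgecm formalisation cell (model-construction
sub-cell, seat mc-binder-2).
-/

set_option autoImplicit false

noncomputable section

open MvPolynomial Complex SchwartzMap MeasureTheory
open scoped BigOperators Real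

namespace Literature.Analysis.SegalBargmann

variable {σ : Type*} [Fintype σ] [DecidableEq σ]

/-! ## §1  Finite Hermite sums -/

section HermiteSum

/-- **`F` is a finite Hermite sum supported on `S`**: `F = Σ_{β∈S} c_β(F) h_β` with `c_β(F) = hermiteCoeff β F` its own
Hermite coefficients (`h_β = hermiteSchwartz (herm β)`). [folklore] -/
def IsHermiteSum (S : Finset (σ →₀ ℕ)) (F : 𝓢(EuclideanSpace ℝ σ, ℂ)) : Prop :=
  ∑ β ∈ S, hermiteCoeff β F • hermiteSchwartz (herm β) = F

variable {S T : Finset (σ →₀ ℕ)} {F G : 𝓢(EuclideanSpace ℝ σ, ℂ)}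

/-- An explicit combination `Σ_{β∈S} c_β h_β` is a Hermite sum supported on `S` (its coefficients ARE the `c_β`,
`hermiteCoeff_sum_smul_herm`). [folklore] -/
theorem isHermiteSum_sum_smul (S : Finset (σ →₀ ℕ)) (c : (σ →₀ ℕ) → ℂ) :
    IsHermiteSum S (∑ β ∈ S, c β • hermiteSchwartz (herm β)) := by
  unfold IsHermiteSum
  refine Finset.sum_congr rfl fun β hβ => ?_
  rw [hermiteCoeff_sum_smul_herm, if_pos hβ]

/-- A Hermite function `h_α`, `α ∈ S`, is a Hermite sum supported on `S`. [folklore] -/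
theorem isHermiteSum_herm {α : σ →₀ ℕ} (hα : α ∈ S) : IsHermiteSum S (hermiteSchwartz (herm α)) := by
  unfold IsHermiteSum
  have h : ∀ β ∈ S, hermiteCoeff β (hermiteSchwartz (herm α)) • hermiteSchwartz (herm β) =
      if β = α then hermiteSchwartz (herm α) else 0 := fun β _ => by
    rw [hermiteCoeff_herm]
    split_ifs with h
    · rw [h, one_smul]
    · rw [zero_smul]
  rw [Finset.sum_congr rfl h, Finset.sum_ite_eq', if_pos hα]

/-- The expansion of a Hermite sum. [folklore] -/
theorem IsHermiteSum.eq (hF : IsHermiteSum S F) :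
    F = ∑ β ∈ S, hermiteCoeff β F • hermiteSchwartz (herm β) :=
  hF.symm

/-- The Hermite coefficients of a Hermite sum supported on `S` vanish off `S`. [folklore] -/
theorem IsHermiteSum.hermiteCoeff_eq_zero (hF : IsHermiteSum S F) {γ : σ →₀ ℕ} (hγ : γ ∉ S) :
    hermiteCoeff γ F = 0 := by
  rw [← hF, hermiteCoeff_sum_smul_herm, if_neg hγ]

/-- Monotonicity of the support. [folklore] -/
theorem IsHermiteSum.mono (hF : IsHermiteSum S F) (hST : S ⊆ T) : IsHermiteSum T F := by
  unfold IsHermiteSum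
  rw [← Finset.sum_subset hST fun β _ hβS => by rw [hF.hermiteCoeff_eq_zero hβS, zero_smul]]
  exact hF

/-- `0` is a Hermite sum (on any support). [folklore] -/
theorem IsHermiteSum.zero : IsHermiteSum S (0 : 𝓢(EuclideanSpace ℝ σ, ℂ)) := by
  have h := isHermiteSum_sum_smul S (fun _ => (0 : ℂ))
  simp only [zero_smul, Finset.sum_const_zero] at h
  exact h

/-- Hermite sums on a common support are closed under addition. [folklore] -/
theorem IsHermiteSum.add (hF : IsHermiteSum S F) (hG : IsHermiteSum S G) : IsHermiteSum S (F + G) := by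
  unfold IsHermiteSum
  simp_rw [hermiteCoeff_add, add_smul, Finset.sum_add_distrib]
  rw [hF, hG]

/-- Hermite sums are closed under scalars. [folklore] -/
theorem IsHermiteSum.smul (hF : IsHermiteSum S F) (c : ℂ) : IsHermiteSum S (c • F) := by
  unfold IsHermiteSum
  simp_rw [hermiteCoeff_smul, mul_smul, ← Finset.smul_sum]
  rw [hF]

/-- Hermite sums on a common support are closed under subtraction. [folklore] -/
theorem IsHermiteSum.sub (hF : IsHermiteSum S F) (hG : IsHermiteSum S G) : IsHermiteSum S (F - G) := by
  rw [sub_eq_add_neg, ← neg_one_smul ℂ G]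
  exact hF.add (hG.smul _)

/-- Hermite sums on a common support are closed under finite sums. [folklore] -/
theorem IsHermiteSum.sum {ι : Type*} (I : Finset ι) (g : ι → 𝓢(EuclideanSpace ℝ σ, ℂ))
    (h : ∀ i ∈ I, IsHermiteSum S (g i)) : IsHermiteSum S (∑ i ∈ I, g i) :=
  Finset.sum_induction g (IsHermiteSum S) (fun _ _ ha hb => ha.add hb) IsHermiteSum.zero h

/-- **Parseval for a Hermite sum**: `∫ ‖F‖² = Σ_{β∈S} ‖c_β(F)‖²`. [cite: Folland1989, §1.7] -/
theorem IsHermiteSum.integral_norm_sq (hF : IsHermiteSum S F) :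
    ∫ x : EuclideanSpace ℝ σ, ‖F x‖ ^ 2 = ∑ β ∈ S, ‖hermiteCoeff β F‖ ^ 2 := by
  have h := integral_norm_sq_sum_smul_herm S (fun β => hermiteCoeff β F)
  rw [hF] at h
  exact h

end HermiteSum

/-! ## §2  The ladder operators on Hermite sums -/

section Ladder

variable (j : σ) (S : Finset (σ →₀ ℕ)) (c : (σ →₀ ℕ) → ℂ)

/-- **`Z_j^* (Σ_β c_β h_β) = Σ_β c_β √((β_j+1)/π) h_{β+1_j}`** (Folland (1.82), creation half). [cite: Folland1989, (1.82)] -/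
theorem zsCLM_sum_smul_herm :
    zsCLM j (∑ β ∈ S, c β • hermiteSchwartz (herm β)) =
      ∑ β ∈ S, (c β * (Real.sqrt ((β j + 1) / π) : ℂ)) • hermiteSchwartz (herm (β + Finsupp.single j 1)) := by
  rw [map_sum]
  refine Finset.sum_congr rfl fun β _ => ?_
  rw [map_smul, zsCLM_herm, smul_smul]

/-- **`Z_j (Σ_β c_β h_β) = Σ_β c_β √(β_j/π) h_{β−1_j}`** (Folland (1.82), annihilation half; the terms with `β_j = 0`
vanish). [cite: Folland1989, (1.82)] -/
theorem zCLM_sum_smul_herm :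
    zCLM j (∑ β ∈ S, c β • hermiteSchwartz (herm β)) =
      ∑ β ∈ S, (c β * (Real.sqrt (β j / π) : ℂ)) • hermiteSchwartz (herm (β - Finsupp.single j 1)) := by
  rw [map_sum]
  refine Finset.sum_congr rfl fun β _ => ?_
  rw [map_smul, zCLM_herm, smul_smul]

omit [Fintype σ] [DecidableEq σ] in
/-- `β ↦ β − 1_j` is injective on `{β_j ≥ 1}`. [folklore] -/
theorem injOn_sub_single (S : Finset (σ →₀ ℕ)) (j : σ) :
    Set.InjOn (fun β : σ →₀ ℕ => β - Finsupp.single j 1) ↑(S.filter fun β => 1 ≤ β j) := by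
  intro β hβ β' hβ' h
  simp only [Finset.coe_filter, Set.mem_setOf_eq] at hβ hβ'
  have h1 : Finsupp.single j 1 ≤ β := Finsupp.single_le_iff.mpr hβ.2
  have h2 : Finsupp.single j 1 ≤ β' := Finsupp.single_le_iff.mpr hβ'.2
  have h3 := congrArg (fun γ : σ →₀ ℕ => γ + Finsupp.single j 1) h
  simpa only [tsub_add_cancel_of_le h1, tsub_add_cancel_of_le h2] using h3

/-- **Parseval value of `Z_j^*` on a Hermite sum**: `∫ ‖Z_j^* (Σ c_β h_β)‖² = Σ_β ‖c_β‖² (β_j+1)/π`.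
[cite: Folland1989, §1.7] -/
theorem integral_norm_sq_zsCLM_sum :
    ∫ x : EuclideanSpace ℝ σ, ‖(zsCLM j (∑ β ∈ S, c β • hermiteSchwartz (herm β))) x‖ ^ 2 =
      ∑ β ∈ S, ‖c β‖ ^ 2 * (((β j : ℝ) + 1) / π) := by
  rw [zsCLM_sum_smul_herm,
    integral_norm_sq_sum_smul_herm_family S (fun β : σ →₀ ℕ => β + Finsupp.single j 1) (injOn_add_single S j)]
  refine Finset.sum_congr rfl fun β _ => ?_
  have h1 : (0 : ℝ) ≤ ((β j : ℝ) + 1) / π := by positivity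
  rw [norm_mul, mul_pow, Complex.norm_real, Real.norm_of_nonneg (Real.sqrt_nonneg _), Real.sq_sqrt h1]

/-- **Parseval value of `Z_j` on a Hermite sum**: `∫ ‖Z_j (Σ c_β h_β)‖² = Σ_β ‖c_β‖² β_j/π`. [cite: Folland1989, §1.7] -/
theorem integral_norm_sq_zCLM_sum :
    ∫ x : EuclideanSpace ℝ σ, ‖(zCLM j (∑ β ∈ S, c β • hermiteSchwartz (herm β))) x‖ ^ 2 =
      ∑ β ∈ S, ‖c β‖ ^ 2 * ((β j : ℝ) / π) := by
  rw [zCLM_sum_smul_herm]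
  -- the terms with `β_j = 0` vanish: restrict to `{β_j ≥ 1}`, where `β ↦ β − 1_j` is injective
  have hsplit : ∑ β ∈ S, (c β * (Real.sqrt (β j / π) : ℂ)) • hermiteSchwartz (herm (β - Finsupp.single j 1)) =
      ∑ β ∈ S.filter (fun β => 1 ≤ β j),
        (c β * (Real.sqrt (β j / π) : ℂ)) • hermiteSchwartz (herm (β - Finsupp.single j 1)) := by
    rw [Finset.sum_filter]
    refine Finset.sum_congr rfl fun β _ => ?_
    split_ifs with h
    · rfl
    · have h0 : β j = 0 := by omega
      simp [h0]
  rw [hsplit, integral_norm_sq_sum_smul_herm_family _ (fun β : σ →₀ ℕ => β - Finsupp.single j 1)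
    (injOn_sub_single S j), Finset.sum_filter]
  refine Finset.sum_congr rfl fun β _ => ?_
  split_ifs with h
  · have h1 : (0 : ℝ) ≤ (β j : ℝ) / π := by positivity
    rw [norm_mul, mul_pow, Complex.norm_real, Real.norm_of_nonneg (Real.sqrt_nonneg _), Real.sq_sqrt h1]
  · have h0 : β j = 0 := by omega
    simp [h0]

/-- **`∫ ‖Z_j^* F‖² ≤ (d+1)/π · Σ‖c_β‖²`** when `β_j ≤ d` on the support. [folklore] -/
theorem integral_norm_sq_zsCLM_sum_le (d : ℕ) (hd : ∀ β ∈ S, β j ≤ d) :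
    ∫ x : EuclideanSpace ℝ σ, ‖(zsCLM j (∑ β ∈ S, c β • hermiteSchwartz (herm β))) x‖ ^ 2 ≤
      (((d : ℝ) + 1) / π) * ∑ β ∈ S, ‖c β‖ ^ 2 := by
  rw [integral_norm_sq_zsCLM_sum, Finset.mul_sum]
  refine Finset.sum_le_sum fun β hβ => ?_
  rw [mul_comm]
  have hβd : ((β j : ℝ) + 1) / π ≤ ((d : ℝ) + 1) / π := by
    apply div_le_div_of_nonneg_right _ Real.pi_pos.le
    exact_mod_cast Nat.add_le_add_right (hd β hβ) 1
  exact mul_le_mul_of_nonneg_right hβd (by positivity)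

/-- **`∫ ‖Z_j F‖² ≤ d/π · Σ‖c_β‖²`** when `β_j ≤ d` on the support. [folklore] -/
theorem integral_norm_sq_zCLM_sum_le (d : ℕ) (hd : ∀ β ∈ S, β j ≤ d) :
    ∫ x : EuclideanSpace ℝ σ, ‖(zCLM j (∑ β ∈ S, c β • hermiteSchwartz (herm β))) x‖ ^ 2 ≤
      ((d : ℝ) / π) * ∑ β ∈ S, ‖c β‖ ^ 2 := by
  rw [integral_norm_sq_zCLM_sum, Finset.mul_sum]
  refine Finset.sum_le_sum fun β hβ => ?_
  rw [mul_comm]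
  have hβd : (β j : ℝ) / π ≤ (d : ℝ) / π := by
    apply div_le_div_of_nonneg_right _ Real.pi_pos.le
    exact_mod_cast hd β hβ
  exact mul_le_mul_of_nonneg_right hβd (by positivity)

end Ladder

/-! ## §3  Elementary `L²` inequalities for Schwartz functions -/

section L2

omit [DecidableEq σ] in
/-- `‖u‖²` is integrable for a Schwartz function `u` (Mathlib `SchwartzMap.memLp`). [folklore] -/
theorem integrable_norm_sq (u : 𝓢(EuclideanSpace ℝ σ, ℂ)) :
    Integrable (fun x : EuclideanSpace ℝ σ => ‖u x‖ ^ 2) :=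
  (u.memLp ((2 : ℕ) : ENNReal)).integrable_norm_pow two_ne_zero

omit [DecidableEq σ] in
/-- `∫ ‖a u‖² = ‖a‖² ∫ ‖u‖²`. [folklore] -/
theorem integral_norm_sq_smul (a : ℂ) (u : 𝓢(EuclideanSpace ℝ σ, ℂ)) :
    ∫ x : EuclideanSpace ℝ σ, ‖(a • u) x‖ ^ 2 = ‖a‖ ^ 2 * ∫ x : EuclideanSpace ℝ σ, ‖u x‖ ^ 2 := by
  rw [← integral_const_mul]
  refine integral_congr_ae (Filter.Eventually.of_forall fun x => ?_)
  simp only [smul_apply, smul_eq_mul, norm_mul, mul_pow]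

omit [DecidableEq σ] in
/-- **`∫ ‖u + v‖² ≤ 2∫ ‖u‖² + 2∫ ‖v‖²`** for Schwartz functions. [folklore] -/
theorem integral_norm_sq_add_le (u v : 𝓢(EuclideanSpace ℝ σ, ℂ)) :
    ∫ x : EuclideanSpace ℝ σ, ‖(u + v) x‖ ^ 2 ≤
      2 * (∫ x : EuclideanSpace ℝ σ, ‖u x‖ ^ 2) + 2 * ∫ x : EuclideanSpace ℝ σ, ‖v x‖ ^ 2 := by
  have hu2 : 2 * (∫ x : EuclideanSpace ℝ σ, ‖u x‖ ^ 2) = ∫ x : EuclideanSpace ℝ σ, 2 * ‖u x‖ ^ 2 :=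
    (integral_const_mul _ _).symm
  have hv2 : 2 * (∫ x : EuclideanSpace ℝ σ, ‖v x‖ ^ 2) = ∫ x : EuclideanSpace ℝ σ, 2 * ‖v x‖ ^ 2 :=
    (integral_const_mul _ _).symm
  rw [hu2, hv2, ← integral_add ((integrable_norm_sq u).const_mul 2) ((integrable_norm_sq v).const_mul 2)]
  refine integral_mono (integrable_norm_sq (u + v))
    (((integrable_norm_sq u).const_mul 2).add ((integrable_norm_sq v).const_mul 2)) fun x => ?_
  have h1 := norm_add_le (u x) (v x)
  have h2 : ‖u x + v x‖ ^ 2 ≤ (‖u x‖ + ‖v x‖) ^ 2 := by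
    nlinarith [norm_nonneg (u x + v x), norm_nonneg (u x), norm_nonneg (v x)]
  show ‖(u + v) x‖ ^ 2 ≤ 2 * ‖u x‖ ^ 2 + 2 * ‖v x‖ ^ 2
  rw [add_apply]
  nlinarith [sq_nonneg (‖u x‖ - ‖v x‖)]

omit [DecidableEq σ] in
/-- **`∫ ‖u − v‖² ≤ 2∫ ‖u‖² + 2∫ ‖v‖²`** for Schwartz functions. [folklore] -/
theorem integral_norm_sq_sub_le (u v : 𝓢(EuclideanSpace ℝ σ, ℂ)) :
    ∫ x : EuclideanSpace ℝ σ, ‖(u - v) x‖ ^ 2 ≤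
      2 * (∫ x : EuclideanSpace ℝ σ, ‖u x‖ ^ 2) + 2 * ∫ x : EuclideanSpace ℝ σ, ‖v x‖ ^ 2 := by
  have h := integral_norm_sq_add_le u (-v)
  have hneg : ∀ x : EuclideanSpace ℝ σ, ‖(-v) x‖ ^ 2 = ‖v x‖ ^ 2 := fun x => by rw [neg_apply, norm_neg]
  simp_rw [hneg, ← sub_eq_add_neg] at h
  exact h

end L2

end Literature.Analysis.SegalBargmann

end
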